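import Mathlib
import HarnessLib
import HarnessLib.Audit
import Summits.AtomisticToContinuum.Statement
import Literature.Geometry.DiscreteGeometry.KissingPatterns
import Literature.MathematicalPhysics.StatisticalMechanics.LennardJonesClusters
import Literature.MathematicalPhysics.StatisticalMechanics.MuGSC
import Literature.MathematicalPhysics.StatisticalMechanics.LennardJonesThermodynamicLimitProofs
import Summits.AtomisticToContinuum.Crystallization.Theses.HullMinimality
import Summits.AtomisticToContinuum.Crystallization.Theorems.ReggeStarCoercivityDefectFreeCrystallizesHullCriterion
import Summits.AtomisticToContinuum.Crystallization.Theorems.PhononSlackCertificatesWindowOptimality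
import HarnessLib.Audit.Status.Attr

/-!
Route: MuStablePoreSplit

# Route MuStablePoreSplit — Mu-stable recurrent normal form splits LJ radial defects into pores and
solids

It suffices to show X = RedMu ∧ A ∧ S ∧ P1 ∧ P2 (decomp-a2c cell, lens 4 «minimal counterexample»,
generation 2: child node of
route RecurrentDefectTrichotomy refining its residual R = RadialDefectRecurrentLimitWindows
stmt-24667). RedMu (RecurrentMuStableLimit,
provable now): every sequence of LJ ground states has a local limit Y ∋ 0 that is uniformly
recurrent along particles, uniformly discrete
and a Sütő μ-ground-state configuration at the coexistence potential e = lim E(N)/N (no finite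
modification lowers U − e·#). A, S: the
parent's clean / torn-capped pieces (stmt-24668/24669, shared verbatim). P1/P2: such a Y that is
radially defective at every scale and
POROUS (some point of space has no point of Y within 9/10) resp. SOLID (covering radius < 9/10)
forces periodic windows for x. The four
kinds exhaust the normal form (excluded middle ×3), giving PeriodicWindows and then
`Crystallization` by the landed hull criterion; each of
A, S, P1, P2 is implied by `Crystallization` in kernel and P1, P2 are implied by R (node file
MuStablePoreSplit.lean: `…_of_radialDefect`,
`…_of_crystallization`, `radialDefectRecurrentLimitWindows_of_pieces`), so the node is EXACT given
RedMu and every open piece weaker.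
Lean: `Summit.AtomisticToContinuum.Crystallization.Theses.HullMinimality.PeriodicWindows`

## Assembly
Pure logic plus landed theorems: `BlancLewin2015_8_holds 3` gives e; RedMu gives the recurrent
μ-stable Y of x; `by_cases` on (∃ a, all
gapped-twelve ∧ all fcc/hcp-close), on (∃ a, all gapped-twelve) and on (∃ z, ∀ w ∈ Y, 9/10 ≤ dist z
w) dispatches to A, S, P1 or P2 (the
solid hypothesis of P2 is the `push Not` of the failed pore), giving PeriodicWindows; then
`PrestressSplitKorn.stub_hullCriterion` (stmt-3243),
`windowOptimality_proof`, `HullMinimality.CrysEnergyLimit_holds` (stmt-0626) and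
`LennardJonesGroundStatesExist_holds` give both conjuncts of
`Crystallization` (deciding theorem `closes` in glue.lean; kernel-checked in the node file, 0
sorry).

Rationale: WHY THIS LINE. Sütő's grand-canonical ground-state configurations
[corpus:paper:arxiv-math-ph_0508004 p.2] (Suto2005; finite-volume selection Suto2011)
give, at the coexistence potential only, two-sided LOCAL inequalities at every site of an infinite
configuration — the Kossel–Stranski
half-crystal energetics of crystal growth [galaxy:panama:311685776670727] made exact: u(w|Y) ≤ e ≤
I(z|Y) (`kossel_sandwich`, proved in the
node file from `IsMuGSC.removal`/`insertion`). Conjunct (ii) of `Crystallization` only asks for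
windows FREQUENTLY in N, so the particle
numbers may be SELECTED (staircase minima of E(N) − eN, stmt-13684) and the minimal counterexample
can be taken μ-stable for free; the
hull/minimality transplant of generation 0 (Furstenberg; Aubry doi:10.1051/jphyscol:1989315)
supplies recurrence. Splitting the radially
defective class by PORE GEOMETRY then separates two different open contents: cohesion / no-foam (P1;
2D analogues HeitmannRadin1980,
Theil2006; discrete-interface energies
[corpus:book:alicandro2023-discrete-variational-problems-with-interfaces p.42]) — where the sandwich
already kills every vacancy-type pore and the census (kit j337583) shows the vacancy family is
exactly the near-e* part of R's world
(excess·L³ ≈ 0.459, no floor) — from solid frustration/strain (P2), whose periodic and glassy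
inhabitants the census finds ≥ 2.26e-2 above
e_hcp (300× the fcc/hcp gap). No prior route uses μ-stability as a FREE hypothesis of a necessary
piece: GrandCanonicalSelection
(dormant) asks transversally that EVERY coexistence μGSC be crystalline (stmt-13680/13681), which
`Crystallization` does not imply.

RANKED CRUXES. #2 SolidDefectLimitWindows (crux) — for the coexistence potential e (E(N)/N → e, e ≤
E(N)/N), every sequence x of LJ ground states and every recurrent local limit Y ∋ 0 of x that is
uniformly discrete, a μGSC of lennardJones at μ = e, radially defective at every scale a ∈ [47/50,1]
(some site not gapped-twelve) and SOLID (every point of space within < 9/10 of Y): x has periodic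
windows (declared RESIDUAL; parent R restricted). [deps: RecurrentMuStableLimit] [difficulty: XL]
(why it might fail: a recurrent hole-free Frank–Kasper-like, icosahedral-approximant or
>2%-anisotropically-strained local limit of LJ ground states, μ-stable at e* with energy density e*:
then P2 is the whole conjecture on that sequence and no collective price is known.)
[FlatleyTheil2015, Theil2006, BlancLewin2015, arXiv:cond-mat/0007338, arXiv:math-ph/0508004,
stmt-AtomisticToContinuum-24667, stmt-AtomisticToContinuum-13958]
#3 PorousDefectLimitWindows (crux) — same normal form as rank 2 but POROUS (some point z of space
with no point of Y within < 9/10, i.e. room for an extra particle): x has periodic windows. Content: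
cohesion / no-foam for μ-stable e*-matter with syndetic pores; vacancy-type pores are excluded now
by the Kossel sandwich u(w|Y) ≤ e ≤ I(z|Y). [deps: RecurrentMuStableLimit] [difficulty: L] (why it
might fail: a recurrent μ-stable LJ sponge with energy density exactly e*: loose pores of radius in
(1, 3/2) pass the one-point insertion test, and excluding syndetic loose pores needs positive 3D
surface tension (open; only 2D analogues proved).) [arXiv:math-ph/0508004, HeitmannRadin1980,
Theil2006, BlancLewin2015, stmt-AtomisticToContinuum-24040, stmt-AtomisticToContinuum-24667]
#4 CleanRecurrentLimitWindows (crux) — SHARED ITEM stmt-AtomisticToContinuum-24668 of route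
RecurrentDefectTrichotomy, verbatim: a recurrent local limit Y ∋ 0 of x all of whose shells at some
scale a ∈ [47/50,1] are gapped-twelve and 1/5-close to fcc or hcp forces periodic windows for x.
[deps: RecurrentMuStableLimit] [difficulty: L] (why it might fail: residual in-layer strain no
translate-limit removes because layered coercivity fails for some relaxed polytype (soft shear
branch), or non-parallel twin junctions compatible with all-clean shells at tolerance 1/5.)
[Hales2012, HalesDSP2012, FlatleyTheil2015, BlancLewin2015, stmt-AtomisticToContinuum-15932,
stmt-AtomisticToContinuum-11779]
#5 TornCappedRecurrentLimitWindows (crux) — SHARED ITEM stmt-AtomisticToContinuum-24669 of route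
RecurrentDefectTrichotomy, verbatim: a recurrent local limit Y ∋ 0 of x all gapped-twelve at some
scale but at no scale all fcc/hcp-close forces periodic windows for x. [deps:
RecurrentMuStableLimit] [difficulty: L] (why it might fail: an all-gapped-twelve recurrent TORN
crystal (torn icosahedral / bicuboctahedral shells sharing voids, cf.
GappedShellCensusShellCensus_refuted) with energy density e*: S stays true but its geometric attack
dies.) [FlatleyTheil2015, Hales2012, MusinTarasov2012, BoroczkySzabo2015,
stmt-AtomisticToContinuum-18069, stmt-AtomisticToContinuum-18070, stmt-AtomisticToContinuum-18071]
#9 RecurrentMuStableLimit (support) — for every e with E(N)/N → e and e ≤ E(N)/N (the coexistence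
potential, `BlancLewin2015_8_holds`), every sequence of LJ ground states has a local limit Y ∋ 0
(two-way ε-matched on B(0,R) by translates of a subsequence, eventually), uniformly recurrent along
particles, uniformly discrete and a μGSC of lennardJones at μ = e. Route: SelectedGrandStability
(stmt-13684) → MuGSCLimitExtraction (stmt-13685) → minimal element of the pointed hull (μ-stability
is closed under separated local limits). [difficulty: provable-now] [arXiv:math-ph/0508004,
doi:10.1051/jphyscol:1989315, BlancLewin2015, stmt-AtomisticToContinuum-13684,
stmt-AtomisticToContinuum-13685, stmt-AtomisticToContinuum-18072]

TWO-LAYER PLAN. P2 ⇐ (P2a: solid normal form with a COORDINATION defect at every scale — ≠ 12 in the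
2 % shell or a sub-0.98a neighbour: tetrahedrally
close-packed / icosahedral world) → (P2b: solid normal form, all twelve-coordinated and uncompressed
at some scale, Hales-annulus intruders at
every scale: anisotropically strained close packings; attack = harmonic/elastic coercivity
stmt-13958) → P2 (BC3 skeleton). P1 ⇐ (P1a: a SNUG
pore — ≥ 11 points of Y within [24/25, 27/25] of the pore centre — is absurd by the insertion test
plus a certified bound e ≥ −0.79, or
constant-free by the neighbour comparison) → (P1b: loose-pore / foam world forces windows: 3D
surface tension) → P1 (BC3 skeleton). RedMu ⇐
stmt-13684 → stmt-13685 → recurrent-core extraction (BC3 skeleton). Nothing filed now.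

KILL CRITERIA. No refutation of A, S, P1 or P2 is possible without refuting `Crystallization` itself
(each is a kernel consequence): a refutation of any
piece closes the SUMMIT conjunct negatively. RedMu is unconditional; its refutation would refute
Sütő's selection principle for LJ (then
pivot to the parent's Red and drop μ-stability). The LINE dies if the census (ASK I-P) finds relaxed
porous periodic LJ structures that pass
the full μ-stability test at e* with energy within 1e-4 of e_hcp (then P1 is as hard as P2: merge
back), or (ASK I-E / I-R(b)) a hole-free
radially-defective periodic structure tying relaxed hcp within 1e-4 (then P2's attack by pricing is
dead; retire to lens-2's morphology split).

NOT DECOMPOSED YET. The collective price of syndetic solid radial defects (inside P2: P2a/P2b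
above); the 3D no-foam / surface-tension input (inside P1b); the
Lean plumbing of the pointed-hull compactness, Zorn minimality and the closure of `IsMuGSC` under
separated local limits (inside RedMu);
a certified lower bound e ≥ −0.79 for the snug-pore rung (inside P1a; cf. lens-1 ASK T-lens1-K).

CHEAPEST FALSIFIER. Kit j337583 (census, cited): vacancy superlattices excess·L³ ≈ 0.459 const
(η_def(L) ≈ 0.46/L³ → 0, the ONLY near-e* radially-defective
family found — porous, μ-unstable by the sandwich); every hole-free all-bad periodic or glassy
minimum found is ≥ 2.26e-2 tree units above
e_hcp (random cells n ≤ 8 floor 2.37e-2, β-Mn 4.57e-2, σ 4.83e-2, A15 6.97e-2, quenched glasses ≈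
6e-2) against e_fcc − e_hcp = 7.25e-5: the
line survives. Next cheapest: ASK I-P (pore insertion energies vs e*: where the one-point sandwich
stops biting) and ASK I-E (elastic floor of
strained hcp at the 2 % window exit, derived estimate ≈ 9e-3 from the census C11 = 16.9), filed to
decomp-a2c-census-1 2026-08-30.

NUMBERS. e_hcp = −0.7175893, e_fcc − e_hcp = 7.25e-5, a_hcp = 0.9713 (tree units, kit j337583); V(r)
< 0 iff r > 2^(−1/6) ≈ 0.891, so every
interaction of a 9/10-pore centre with Y is attractive; hcp vacancy: 12 neighbours at 0.9713 ≥ 9/10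
(pore), octahedral interstice at
0.687 (not a pore); gapped-twelve box [0.98a, 1.02a], Hales annulus (1.02a, 1.26a), a ∈ [47/50, 1];
LJ minimal distance 1/3
(LennardJonesMinimalDistance_holds); E_vac relaxed ≈ 0.7075 (j337583).

DEFINITION REQUESTS. None: all pieces are closed Props over existing declarations (`IsMuGSC`,
`UniformlyDiscrete` landed in Literature/…/MuGSC.lean).

Novelty: Searches (2026-08-30): lit search --hybrid "grand canonical ground state configuration chemical
potential Sütő Lennard-Jones" (8 books, none on μGSCs: Friedli–Velenik p.192 nearest); lit search
"Suto crystalline ground states infinite configuration stability chemical potential" (5 local: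
arxiv-math-ph_0508004 p.2 = the μGSC definition; arxiv-1804.05743; doi-10-1007-s10955-020-02603-2);
lit galaxy search "ground state configuration for chemical potential|Kossel crystal|half-crystal
position" --star all (20 rows: crystal-growth monographs panama:311685776670727 Sunagawa,
panama:500398049722397 Tsao; no mathematical use); lit vsearch "surface energy term N^(2/3)
minimizers Lennard-Jones three dimensions Wulff" (8: alicandro2023 pp.42–44 nearest; no 3D result);
lit search "Friesecke Schmidt surface energy crystallization N^(1/2)" (1: arxiv-1505.02919); tree:
rg IsMuGSC / GrandCanonicalSelection / SurfaceTensionNoFoam / BondOrderParameterSplit.Cohesion.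
Nearest prior art found: [corpus:paper:arxiv-math-ph_0508004 p.2] Sütő 2005 (μGSC notion; proves
crystalline GSCs for special Fourier-positive potentials, not LJ); in tree: route
GrandCanonicalSelection (stmt-13680–13690, dormant: transverse «every coexistence μGSC is
crystalline», plus the typed provable supports 13684/13685 this route re-uses by name); lens-6
BondOrderParameterSplit.Cohesion stmt-24040 (transverse exposed-site density → 0); parent
RecurrentDefectTrichotomy (no μ-stability, no pore split).
Delta: μ-stability at th  [refs: arxiv-math-ph_0508004, arxiv-1804.05743, doi-10-1007-s10955-020-02603-2, arxiv-1505.02919, paper:arxiv-math-ph_0508004]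

Barriers (technique_class: hull-minimality, grand-canonical-stability, pore-geometry): - technique_class: hull-minimality, grand-canonical-stability, pore-geometry
- Literature.Barriers.AtomisticToContinuum.TetrahedralFrustration: bites on P2's attack only (single
icosahedral shells are locally cheaper; EffectiveLocalHales 4146 and ShellCensus 15929 refuted); it
does not bite P1 (pores, not shells) nor RedMu (soft); the bet for P2 is a collective price under
recurrence + μ-stability — honest: none is known, P2 is the declared residual.
- Literature.Barriers.AtomisticToContinuum.IcosahedralClusters: same as above; no single-shell price
is claimed anywhere in the route; the sandwich inequalities are exact consequences of μ-stability,
not shell prices.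
- Literature.Barriers.AtomisticToContinuum.DecahedralSoftShell: same; capped shells live in S
(parent's attack by five-fold rationing 18071), not priced.
- Literature.Barriers.AtomisticToContinuum.FlexibleKissingArrangements: evaded in A and S as in the
parent / GappedShellCensus (Hales gap removes the jitterbug path); P1/P2 never infer rigidity from
one shell.
- Literature.Barriers.AtomisticToContinuum.KissingTwelveDegeneracy: idem; the shape clause is only
used together with the radial gap.
- Literature.Barriers.AtomisticToContinuum.ShortRangeStackingBlindness: discharged in tree —
PeriodicWindows admits ANY periodic polytype; stacking selection happens inside the hull
(PeriodicGivenLayered_of).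
- Literature.Barriers.AtomisticToContinuum.HcpNotBravais: PeriodicConfiguration allows a motif, so
hcp is admissible.
-

sub-problem: Crystallization · status: open · opened planner-decomp-a2c-lens-4-g2-0 2026-08-30T02:58:51Z · rev 0 · ledger route-AtomisticToContinuum-MuStablePoreSplit
GENERATED by the gate from the ledger (D-0016/17). Provers cite these decls: `theorem foo : Summit.AtomisticToContinuum.Crystallization.Theses.MuStablePoreSplit.<Decl> := …` in Summits/AtomisticToContinuum/Crystallization/Theorems/<Name>.lean.
-/

namespace Summit.AtomisticToContinuum.Crystallization.Theses.MuStablePoreSplit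

open scoped BigOperators Topology Manifold Classical MeasureTheory ProbabilityTheory Matrix InnerProductSpace ComplexConjugate ContinuousMap
open Filter Set Function TopologicalSpace MeasureTheory

attribute [summit_statement] _root_.Crystallization

/-- item stmt-AtomisticToContinuum-26046 · crux · rank 2 · open · by planner
why it might fail: a recurrent hole-free Frank–Kasper-like, icosahedral-approximant or >2%-anisotropically-strained local limit of LJ ground states, μ-stable at e* with energy density e*: then P2 is the whole conjecture on that sequence and no collective price is known.
sources: FlatleyTheil2015, Theil2006, BlancLewin2015, arXiv:cond-mat/0007338, arXiv:math-ph/0508004, stmt-AtomisticToContinuum-24667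
[crux] for the coexistence potential e (E(N)/N → e, e ≤ E(N)/N), every sequence x of LJ ground
states and every recurrent local limit Y ∋ 0 of x that is uniformly discrete, a μGSC of lennardJones
at μ = e, radially defective at every scale a ∈ [47/50,1] (some site not gapped-twelve) and SOLID
(every point of space within < 9/10 of Y): x has periodic windows (declared RESIDUAL; parent R
restricted). [deps: RecurrentMuStableLimit] [difficulty: XL] -/
@[route_item "route-AtomisticToContinuum-MuStablePoreSplit", crux]
def SolidDefectLimitWindows : Prop :=
  ∀ e : ℝ, Filter.Tendsto (fun N : ℕ => Literature.MathematicalPhysics.StatisticalMechanics.groundStateEnergy Literature.MathematicalPhysics.StatisticalMechanics.lennardJones 3 N / N) Filter.atTop (nhds e) → (∀ N : ℕ, 0 < N → e ≤ Literature.MathematicalPhysics.StatisticalMechanics.groundStateEnergy Literature.MathematicalPhysics.StatisticalMechanics.lennardJones 3 N / N) → ∀ x : (N : ℕ) → (Fin N → EuclideanSpace ℝ (Fin 3)), (∀ N, Literature.MathematicalPhysics.StatisticalMechanics.IsGroundState Literature.MathematicalPhysics.StatisticalMechanics.lennardJones (x N)) → ∀ Y : Set (EuclideanSpace ℝ (Fin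 3)), (0 : EuclideanSpace ℝ (Fin 3)) ∈ Y → (∀ R ε : ℝ, 0 < ε → ∃ L : ℝ, ∀ p ∈ Y, ∀ q ∈ Y, ∃ q' ∈ Y, dist q' q ≤ L ∧ (∀ y ∈ Y, dist y p ≤ R → ∃ y' ∈ Y, dist (y' - q') (y - p) ≤ ε) ∧ (∀ y' ∈ Y, dist y' q' ≤ R → ∃ y ∈ Y, dist (y' - q') (y - p) ≤ ε)) → (∃ (φ : ℕ → ℕ) (t : ℕ → EuclideanSpace ℝ (Fin 3)), StrictMono φ ∧ ∀ R ε : ℝ, 0 < ε → ∀ᶠ n in Filter.atTop, (∀ y ∈ Y, ‖y‖ ≤ R → ∃ i : Fin (φ n), dist (x (φ n) i + t n) y ≤ ε) ∧ (∀ i : Fin (φ n), ‖x (φ n) i + t n‖ ≤ R → ∃ y ∈ Y, dist (x (φ n) i + t n) y ≤ ε)) → Literature.MathematicalPhysics.StatisticalMechanics.UniformlyDiscrete Y → Literature.MathematicalPhysics.StatisticalMechanics.IsMuGSC Literature.MathematicalPhysics.StatisticalMechanics.lennardJones e Y → (¬ (∃ a : ℝ, 47 / 50 ≤ a ∧ a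 ≤ 1 ∧ ∀ y ∈ Y, ({w ∈ Y | w ≠ y ∧ dist y w ≤ a * (1 + 1 / 50)}.ncard = 12 ∧ ∀ w ∈ Y, w ≠ y → a * (1 - 1 / 50) ≤ dist y w ∧ (dist y w ≤ a * (1 + 1 / 50) ∨ a * (63 / 50) ≤ dist y w)))) → (∀ z : EuclideanSpace ℝ (Fin 3), ∃ w ∈ Y, dist z w < 9 / 10) → ∃ W : Literature.MathematicalPhysics.StatisticalMechanics.PeriodicConfiguration 3, ∀ R ε : ℝ, 0 < ε → ∃ᶠ N in Filter.atTop, ∃ t : EuclideanSpace ℝ (Fin 3), (∀ s ∈ W.points, ‖s‖ ≤ R → ∃ i : Fin N, dist (x N i + t) s ≤ ε) ∧ (∀ i : Fin N, ‖x N i + t‖ ≤ R → ∃ s ∈ W.points, dist (x N i + t) s ≤ ε)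

/-- item stmt-AtomisticToContinuum-26047 · crux · rank 3 · open · by planner
why it might fail: a recurrent μ-stable LJ sponge with energy density exactly e*: loose pores of radius in (1, 3/2) pass the one-point insertion test, and excluding syndetic loose pores needs positive 3D surface tension (open; only 2D analogues proved).
sources: arXiv:math-ph/0508004, HeitmannRadin1980, Theil2006, BlancLewin2015, stmt-AtomisticToContinuum-24040, stmt-AtomisticToContinuum-24667
[crux] same normal form as rank 2 but POROUS (some point z of space with no point of Y within <
9/10, i.e. room for an extra particle): x has periodic windows. Content: cohesion / no-foam for
μ-stable e*-matter with syndetic pores; vacancy-type pores are excluded now by the Kossel sandwich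
u(w|Y) ≤ e ≤ I(z|Y). [deps: RecurrentMuStableLimit] [difficulty: L] -/
@[route_item "route-AtomisticToContinuum-MuStablePoreSplit", crux]
def PorousDefectLimitWindows : Prop :=
  ∀ e : ℝ, Filter.Tendsto (fun N : ℕ => Literature.MathematicalPhysics.StatisticalMechanics.groundStateEnergy Literature.MathematicalPhysics.StatisticalMechanics.lennardJones 3 N / N) Filter.atTop (nhds e) → (∀ N : ℕ, 0 < N → e ≤ Literature.MathematicalPhysics.StatisticalMechanics.groundStateEnergy Literature.MathematicalPhysics.StatisticalMechanics.lennardJones 3 N / N) → ∀ x : (N : ℕ) → (Fin N → EuclideanSpace ℝ (Fin 3)), (∀ N, Literature.MathematicalPhysics.StatisticalMechanics.IsGroundState Literature.MathematicalPhysics.StatisticalMechanics.lennardJones (x N)) → ∀ Y : Set (EuclideanSpace ℝ (Fin 3)), (0 : EuclideanSpace ℝ (Fin 3)) ∈ Y → (∀ R ε : ℝ, 0 < ε → ∃ L : ℝ, ∀ p ∈ Y, ∀ q ∈ Y, ∃ q' ∈ Y, dist q' q ≤ L ∧ (∀ y ∈ Y, dist y p ≤ R → ∃ y' ∈ Y,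 dist (y' - q') (y - p) ≤ ε) ∧ (∀ y' ∈ Y, dist y' q' ≤ R → ∃ y ∈ Y, dist (y' - q') (y - p) ≤ ε)) → (∃ (φ : ℕ → ℕ) (t : ℕ → EuclideanSpace ℝ (Fin 3)), StrictMono φ ∧ ∀ R ε : ℝ, 0 < ε → ∀ᶠ n in Filter.atTop, (∀ y ∈ Y, ‖y‖ ≤ R → ∃ i : Fin (φ n), dist (x (φ n) i + t n) y ≤ ε) ∧ (∀ i : Fin (φ n), ‖x (φ n) i + t n‖ ≤ R → ∃ y ∈ Y, dist (x (φ n) i + t n) y ≤ ε)) → Literature.MathematicalPhysics.StatisticalMechanics.UniformlyDiscrete Y → Literature.MathematicalPhysics.StatisticalMechanics.IsMuGSC Literature.MathematicalPhysics.StatisticalMechanics.lennardJones e Y → (¬ (∃ a : ℝ, 47 / 50 ≤ a ∧ a ≤ 1 ∧ ∀ y ∈ Y, ({w ∈ Y | w ≠ y ∧ dist y w ≤ a * (1 + 1 / 50)}.ncard = 12 ∧ ∀ w ∈ Y, w ≠ y → a * (1 - 1 / 50) ≤ dist y w ∧ (dist y w ≤ a * (1 + 1 / 50) ∨ a * (63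 / 50) ≤ dist y w)))) → (∃ z : EuclideanSpace ℝ (Fin 3), ∀ w ∈ Y, 9 / 10 ≤ dist z w) → ∃ W : Literature.MathematicalPhysics.StatisticalMechanics.PeriodicConfiguration 3, ∀ R ε : ℝ, 0 < ε → ∃ᶠ N in Filter.atTop, ∃ t : EuclideanSpace ℝ (Fin 3), (∀ s ∈ W.points, ‖s‖ ≤ R → ∃ i : Fin N, dist (x N i + t) s ≤ ε) ∧ (∀ i : Fin N, ‖x N i + t‖ ≤ R → ∃ s ∈ W.points, dist (x N i + t) s ≤ ε)

/-- item stmt-AtomisticToContinuum-24668 · crux · rank 4 · open · by planner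
why it might fail: residual in-layer strain no translate-limit removes because layered coercivity fails for some relaxed polytype (soft shear branch), or non-parallel twin junctions compatible with all-clean shells at tolerance 1/5.
sources: Hales2012, HalesDSP2012, FlatleyTheil2015, BlancLewin2015, stmt-AtomisticToContinuum-15932, stmt-AtomisticToContinuum-11779
[crux] for every sequence x of LJ ground states and every recurrent local limit Y ∋ 0 of x, if at
some scale a ∈ [47/50,1] every site is gapped-twelve with bond shell 1/5-close to fcc or hcp, then x
has periodic windows (= GappedShellCensus.CleanLimitsHaveWindows stmt-15932 with recurrence added).
[deps: RecurrentLocalLimit] [difficulty: L] -/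
@[route_item "route-AtomisticToContinuum-MuStablePoreSplit", crux]
def CleanRecurrentLimitWindows : Prop :=
  ∀ x : (N : ℕ) → (Fin N → EuclideanSpace ℝ (Fin 3)), (∀ N, Literature.MathematicalPhysics.StatisticalMechanics.IsGroundState Literature.MathematicalPhysics.StatisticalMechanics.lennardJones (x N)) → ∀ Y : Set (EuclideanSpace ℝ (Fin 3)), (0 : EuclideanSpace ℝ (Fin 3)) ∈ Y → (∀ R ε : ℝ, 0 < ε → ∃ L : ℝ, ∀ p ∈ Y, ∀ q ∈ Y, ∃ q' ∈ Y, dist q' q ≤ L ∧ (∀ y ∈ Y, dist y p ≤ R → ∃ y' ∈ Y, dist (y' - q') (y - p) ≤ ε) ∧ (∀ y' ∈ Y, dist y' q' ≤ R → ∃ y ∈ Y, dist (y' - q') (y - p) ≤ ε)) → (∃ (φ : ℕ → ℕ) (t : ℕ → EuclideanSpace ℝ (Fin 3)), StrictMono φ ∧ ∀ R ε : ℝ, 0 < ε → ∀ᶠ n in Filter.atTop, (∀ y ∈ Y, ‖y‖ ≤ R → ∃ i : Fin (φ n), dist (x (φ n) i + t n) y ≤ ε) ∧ (∀ i : Fin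 (φ n), ‖x (φ n) i + t n‖ ≤ R → ∃ y ∈ Y, dist (x (φ n) i + t n) y ≤ ε)) → (∃ a : ℝ, 47 / 50 ≤ a ∧ a ≤ 1 ∧ ∀ y ∈ Y, ({w ∈ Y | w ≠ y ∧ dist y w ≤ a * (1 + 1 / 50)}.ncard = 12 ∧ ∀ w ∈ Y, w ≠ y → a * (1 - 1 / 50) ≤ dist y w ∧ (dist y w ≤ a * (1 + 1 / 50) ∨ a * (63 / 50) ≤ dist y w)) ∧ (∃ T : Finset (EuclideanSpace ℝ (Fin 3)), (↑T : Set (EuclideanSpace ℝ (Fin 3))) = (fun w => a⁻¹ • (w - y)) '' {w ∈ Y | w ≠ y ∧ dist y w ≤ a * (1 + 1 / 50)} ∧ (Literature.Geometry.DiscreteGeometry.ShellCloseTo (1 / 5) T Literature.Geometry.DiscreteGeometry.fccKissingPattern ∨ Literature.Geometry.DiscreteGeometry.ShellCloseTo (1 / 5) T Literature.Geometry.DiscreteGeometry.hcpKissingPattern))) → ∃ W : Literature.MathematicalPhysics.StatisticalMechanics.PeriodicConfiguration 3, ∀ R ε : ℝ, 0 < ε → ∃ᶠ N in Filter.atTop,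 ∃ t : EuclideanSpace ℝ (Fin 3), (∀ s ∈ W.points, ‖s‖ ≤ R → ∃ i : Fin N, dist (x N i + t) s ≤ ε) ∧ (∀ i : Fin N, ‖x N i + t‖ ≤ R → ∃ s ∈ W.points, dist (x N i + t) s ≤ ε)

/-- item stmt-AtomisticToContinuum-24669 · crux · rank 5 · open · by planner
why it might fail: an all-gapped-twelve recurrent TORN crystal (torn icosahedral / bicuboctahedral shells sharing voids, cf. GappedShellCensusShellCensus_refuted) with energy density e*: S stays true but its geometric attack dies.
sources: FlatleyTheil2015, Hales2012, MusinTarasov2012, BoroczkySzabo2015, stmt-AtomisticToContinuum-18069, stmt-AtomisticToContinuum-18070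
[crux] for every sequence x of LJ ground states and every recurrent local limit Y ∋ 0 of x, if at
some scale a ∈ [47/50,1] every site is gapped-twelve but at no scale are all shells fcc/hcp-close,
then x has periodic windows (attack: ShellTrichotomy 18070 + TornFree 18069 + recurrence ⇒ R-dense
five-fold axes, forbidden by FiveFoldRationingR 18071). [deps: RecurrentLocalLimit] [difficulty: L] -/
@[route_item "route-AtomisticToContinuum-MuStablePoreSplit", crux]
def TornCappedRecurrentLimitWindows : Prop :=
  ∀ x : (N : ℕ) → (Fin N → EuclideanSpace ℝ (Fin 3)), (∀ N, Literature.MathematicalPhysics.StatisticalMechanics.IsGroundState Literature.MathematicalPhysics.StatisticalMechanics.lennardJones (x N)) → ∀ Y : Set (EuclideanSpace ℝ (Fin 3)), (0 : EuclideanSpace ℝ (Fin 3)) ∈ Y → (∀ R ε : ℝ, 0 < ε → ∃ L : ℝ, ∀ p ∈ Y, ∀ q ∈ Y, ∃ q' ∈ Y, dist q' q ≤ L ∧ (∀ y ∈ Y, dist y p ≤ R → ∃ y' ∈ Y, dist (y' - q') (y - p) ≤ ε) ∧ (∀ y' ∈ Y, dist y' q' ≤ R → ∃ y ∈ Y, dist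 (y' - q') (y - p) ≤ ε)) → (∃ (φ : ℕ → ℕ) (t : ℕ → EuclideanSpace ℝ (Fin 3)), StrictMono φ ∧ ∀ R ε : ℝ, 0 < ε → ∀ᶠ n in Filter.atTop, (∀ y ∈ Y, ‖y‖ ≤ R → ∃ i : Fin (φ n), dist (x (φ n) i + t n) y ≤ ε) ∧ (∀ i : Fin (φ n), ‖x (φ n) i + t n‖ ≤ R → ∃ y ∈ Y, dist (x (φ n) i + t n) y ≤ ε)) → (∃ a : ℝ, 47 / 50 ≤ a ∧ a ≤ 1 ∧ ∀ y ∈ Y, ({w ∈ Y | w ≠ y ∧ dist y w ≤ a * (1 + 1 / 50)}.ncard = 12 ∧ ∀ w ∈ Y, w ≠ y → a * (1 - 1 / 50) ≤ dist y w ∧ (dist y w ≤ a * (1 + 1 / 50) ∨ a * (63 / 50) ≤ dist y w))) → (¬ (∃ a : ℝ, 47 / 50 ≤ a ∧ a ≤ 1 ∧ ∀ y ∈ Y, ({w ∈ Y | w ≠ y ∧ dist y w ≤ a * (1 + 1 / 50)}.ncard = 12 ∧ ∀ w ∈ Y, w ≠ y → a * (1 - 1 / 50) ≤ dist y w ∧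 (dist y w ≤ a * (1 + 1 / 50) ∨ a * (63 / 50) ≤ dist y w)) ∧ (∃ T : Finset (EuclideanSpace ℝ (Fin 3)), (↑T : Set (EuclideanSpace ℝ (Fin 3))) = (fun w => a⁻¹ • (w - y)) '' {w ∈ Y | w ≠ y ∧ dist y w ≤ a * (1 + 1 / 50)} ∧ (Literature.Geometry.DiscreteGeometry.ShellCloseTo (1 / 5) T Literature.Geometry.DiscreteGeometry.fccKissingPattern ∨ Literature.Geometry.DiscreteGeometry.ShellCloseTo (1 / 5) T Literature.Geometry.DiscreteGeometry.hcpKissingPattern)))) → ∃ W : Literature.MathematicalPhysics.StatisticalMechanics.PeriodicConfiguration 3, ∀ R ε : ℝ, 0 < ε → ∃ᶠ N in Filter.atTop, ∃ t : EuclideanSpace ℝ (Fin 3), (∀ s ∈ W.points, ‖s‖ ≤ R → ∃ i : Fin N, dist (x N i + t) s ≤ ε) ∧ (∀ i : Fin N, ‖x N i + t‖ ≤ R → ∃ s ∈ W.points, dist (x N i + t) s ≤ ε)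

/-- item stmt-AtomisticToContinuum-26048 · support · rank 9 · open · by planner
sources: arXiv:math-ph/0508004, doi:10.1051/jphyscol:1989315, BlancLewin2015, stmt-AtomisticToContinuum-13684, stmt-AtomisticToContinuum-13685, stmt-AtomisticToContinuum-18072
[support] for every e with E(N)/N → e and e ≤ E(N)/N (the coexistence potential,
`BlancLewin2015_8_holds`), every sequence of LJ ground states has a local limit Y ∋ 0 (two-way
ε-matched on B(0,R) by translates of a subsequence, eventually), uniformly recurrent along
particles, uniformly discrete and a μGSC of lennardJones at μ = e. Route: SelectedGrandStability
(stmt-13684) → MuGSCLimitExtraction (stmt-13685) → minimal element of the pointed hull (μ-stability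
is closed under separated local limits). [difficulty: provable-now] -/
@[route_item "route-AtomisticToContinuum-MuStablePoreSplit", crux]
def RecurrentMuStableLimit : Prop :=
  ∀ e : ℝ, Filter.Tendsto (fun N : ℕ => Literature.MathematicalPhysics.StatisticalMechanics.groundStateEnergy Literature.MathematicalPhysics.StatisticalMechanics.lennardJones 3 N / N) Filter.atTop (nhds e) → (∀ N : ℕ, 0 < N → e ≤ Literature.MathematicalPhysics.StatisticalMechanics.groundStateEnergy Literature.MathematicalPhysics.StatisticalMechanics.lennardJones 3 N / N) → ∀ x : (N : ℕ) → (Fin N → EuclideanSpace ℝ (Fin 3)), (∀ N, Literature.MathematicalPhysics.StatisticalMechanics.IsGroundState Literature.MathematicalPhysics.StatisticalMechanics.lennardJones (x N)) → ∃ Y : Set (EuclideanSpace ℝ (Fin 3)), (0 : EuclideanSpace ℝ (Fin 3)) ∈ Y ∧ (∀ R ε : ℝ, 0 < ε → ∃ L : ℝ, ∀ p ∈ Y, ∀ q ∈ Y, ∃ q' ∈ Y, dist q' q ≤ L ∧ (∀ y ∈ Y, dist y p ≤ R → ∃ y' ∈ Y, dist (y' - q') (y - p) ≤ ε) ∧ (∀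 y' ∈ Y, dist y' q' ≤ R → ∃ y ∈ Y, dist (y' - q') (y - p) ≤ ε)) ∧ (∃ (φ : ℕ → ℕ) (t : ℕ → EuclideanSpace ℝ (Fin 3)), StrictMono φ ∧ ∀ R ε : ℝ, 0 < ε → ∀ᶠ n in Filter.atTop, (∀ y ∈ Y, ‖y‖ ≤ R → ∃ i : Fin (φ n), dist (x (φ n) i + t n) y ≤ ε) ∧ (∀ i : Fin (φ n), ‖x (φ n) i + t n‖ ≤ R → ∃ y ∈ Y, dist (x (φ n) i + t n) y ≤ ε)) ∧ Literature.MathematicalPhysics.StatisticalMechanics.UniformlyDiscrete Y ∧ Literature.MathematicalPhysics.StatisticalMechanics.IsMuGSC Literature.MathematicalPhysics.StatisticalMechanics.lennardJones e Y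

/-- item stmt-AtomisticToContinuum-26049 · assembly · rank 1 · open · by planner
sources: stmt-AtomisticToContinuum-3243, stmt-AtomisticToContinuum-11780
[assembly] RedMu → A → S → P1 → P2 → Crystallization -/
@[route_item "route-AtomisticToContinuum-MuStablePoreSplit"]
def Assembly : Prop :=
  RecurrentMuStableLimit → CleanRecurrentLimitWindows → TornCappedRecurrentLimitWindows → PorousDefectLimitWindows → SolidDefectLimitWindows → _root_.Crystallization

/-! D-0027 §2.1 — DECIDING THEOREM (planner-authored via `route open/edit --closes-file`; by planner-decomp-a2c-lens-4-g2-0 2026-08-30T02:58:51Z):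
its hypotheses are this route's items and its conclusion the sub-problem Statement (glue_lint), and it elaborates with this file. -/

@[closes "route-AtomisticToContinuum-MuStablePoreSplit"] theorem closes (h_RecurrentMuStableLimit : RecurrentMuStableLimit) (h_CleanRecurrentLimitWindows : CleanRecurrentLimitWindows)
    (h_TornCappedRecurrentLimitWindows : TornCappedRecurrentLimitWindows)
    (h_PorousDefectLimitWindows : PorousDefectLimitWindows)
    (h_SolidDefectLimitWindows : SolidDefectLimitWindows) : _root_.Crystallization := by
  -- (1) PERIODIC WINDOWS for every ground-state sequence: the coexistence potential `e` (`BlancLewin2015_8_holds`), the recurrent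
  --     μ-stable local limit `Y ∋ 0` of `x` (RedMu), then excluded middle ×3: clean (A) / torn-capped (S) / radially defective and
  --     porous (P1) / radially defective and solid (P2).
  have hPW : _root_.Summit.AtomisticToContinuum.Crystallization.Theses.HullMinimality.PeriodicWindows := by
    intro x hx
    obtain ⟨e, -, hT, hlb⟩ :=
      Literature.MathematicalPhysics.StatisticalMechanics.BlancLewin2015_8_holds 3 (by norm_num) (by norm_num)
    obtain ⟨Y, h0, hrec, hlim, hUD, hμ⟩ := h_RecurrentMuStableLimit e hT hlb x hx
    by_cases hclean : (∃ a : ℝ, 47 / 50 ≤ a ∧ a ≤ 1 ∧ ∀ y ∈ Y, ({w ∈ Y | w ≠ y ∧ dist y w ≤ a * (1 + 1 / 50)}.ncard = 12 ∧ ∀ w ∈ Y, w ≠ y → a * (1 - 1 / 50) ≤ dist y w ∧ (dist y w ≤ a * (1 + 1 / 50) ∨ a * (63 / 50) ≤ dist y w)) ∧ (∃ T : Finset (EuclideanSpace ℝ (Fin 3)), (↑T : Set (EuclideanSpace ℝ (Fin 3))) = (fun w => a⁻¹ • (w - y)) '' {w ∈ Y | w ≠ y ∧ dist y w ≤ a *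 (1 + 1 / 50)} ∧ (Literature.Geometry.DiscreteGeometry.ShellCloseTo (1 / 5) T Literature.Geometry.DiscreteGeometry.fccKissingPattern ∨ Literature.Geometry.DiscreteGeometry.ShellCloseTo (1 / 5) T Literature.Geometry.DiscreteGeometry.hcpKissingPattern)))
    · exact h_CleanRecurrentLimitWindows x hx Y h0 hrec hlim hclean
    · by_cases hgap : (∃ a : ℝ, 47 / 50 ≤ a ∧ a ≤ 1 ∧ ∀ y ∈ Y, ({w ∈ Y | w ≠ y ∧ dist y w ≤ a * (1 + 1 / 50)}.ncard = 12 ∧ ∀ w ∈ Y, w ≠ y → a * (1 - 1 / 50) ≤ dist y w ∧ (dist y w ≤ a * (1 + 1 / 50) ∨ a * (63 / 50) ≤ dist y w)))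
      · exact h_TornCappedRecurrentLimitWindows x hx Y h0 hrec hlim hgap hclean
      · by_cases hpore : (∃ z : EuclideanSpace ℝ (Fin 3), ∀ w ∈ Y, 9 / 10 ≤ dist z w)
        · exact h_PorousDefectLimitWindows e hT hlb x hx Y h0 hrec hlim hUD hμ hgap hpore
        · refine h_SolidDefectLimitWindows e hT hlb x hx Y h0 hrec hlim hUD hμ hgap fun z => ?_
          by_contra hz
          push Not at hz
          exact hpore ⟨z, hz⟩
  -- (2) positional conjunct (ii): the landed hull criterion (stmt-3243, `PrestressSplitKorn.stub_hullCriterion`).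
  refine ⟨?_, _root_.Summit.AtomisticToContinuum.Crystallization.Theorems.PrestressSplitKorn.stub_hullCriterion hPW⟩
  -- (3) energetic conjunct (i): ground states exist; their window configuration is a periodic minimiser
  --     (`windowOptimality_proof`), so `⨅ = e(P)`, and `E(N)/N → ⨅` (`HullMinimality.CrysEnergyLimit_holds`, stmt-0626).
  have hWO := _root_.Summit.AtomisticToContinuum.Crystallization.Theorems.windowOptimality_proof
  unfold _root_.Summit.AtomisticToContinuum.Crystallization.Theses.PhononSlackCertificates.WindowOptimality at hWO
  obtain ⟨x, hx⟩ : ∃ x : (N : ℕ) → (Fin N → EuclideanSpace ℝ (Fin 3)),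
      ∀ N, Literature.MathematicalPhysics.StatisticalMechanics.IsGroundState
        Literature.MathematicalPhysics.StatisticalMechanics.lennardJones (x N) :=
    ⟨fun N => (Literature.MathematicalPhysics.StatisticalMechanics.LennardJonesGroundStatesExist_holds N).choose,
      fun N => (Literature.MathematicalPhysics.StatisticalMechanics.LennardJonesGroundStatesExist_holds N).choose_spec⟩
  obtain ⟨P, hP⟩ := hPW x hx
  have hleast : IsLeast (Set.range fun Q : Literature.MathematicalPhysics.StatisticalMechanics.PeriodicConfiguration 3 =>
      Q.energyPerParticle Literature.MathematicalPhysics.StatisticalMechanics.lennardJones)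
      (P.energyPerParticle Literature.MathematicalPhysics.StatisticalMechanics.lennardJones) := hWO x hx P hP
  have hinf : (⨅ Q : Literature.MathematicalPhysics.StatisticalMechanics.PeriodicConfiguration 3,
      Q.energyPerParticle Literature.MathematicalPhysics.StatisticalMechanics.lennardJones) =
      P.energyPerParticle Literature.MathematicalPhysics.StatisticalMechanics.lennardJones := hleast.csInf_eq
  have hE := _root_.Summit.AtomisticToContinuum.Crystallization.Theses.HullMinimality.CrysEnergyLimit_holds
  unfold _root_.Summit.AtomisticToContinuum.Crystallization.Theses.HullMinimality.CrysEnergyLimit at hE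
  rw [hinf] at hE
  exact ⟨P, hleast, hE⟩

end Summit.AtomisticToContinuum.Crystallization.Theses.MuStablePoreSplit
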